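import Summits.ResolutionOfSingularities.ResolutionOfSingularities.Theorems.LossEntryW18
import HarnessLib

/-!
# LossEntryW19 (= lens-3 g29 slice 11) — walk plumbing of the loss→entry law — the V-LEMMA FOR THE WALL LETTER and the β-step law in EFFECTIVE form

decomp-res-lens-3, gen 29 (NODE-g29 §3ter (R2)).  TOOL at 0.  Imports `Theorems.LossEntryW18` (§30, (N5) discharged).

§31 — THE V-LEMMA FOR THE WALL LETTER (NODE-g29 §3ter (R2)): `fst_resPoint_shearExp_thd` (abscissa of a monomial with `n` ceiling
letters converted into the wall letter: `(D a + n − r a)/(d + n)`), **`vertexOf_polyPts_shear_wall`** (a wall-preserving shear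
`σ_{c,a,κ} : u_c ↦ u_c + κ u_a` does NOT move the lex-min vertex of the frame-`(a, b ; c)` point set when the wall `u_a^{r a}` divides the
equation, the set is non-empty and its abscissa is `< 1`: every spawned point lies strictly to the right of the vertex), its corollary
**`betaOf_polyPts_shear_wall`** (`ŷ` and `x̂` unchanged), and the walk-level **β-STEP ORDINATE LAW IN EFFECTIVE FORM**
**`betaOf_polyPts_straightened_succ_beta_le''`**: at a β-loss `v` (chart = the section letter `b`, `b_v(a) ≠ 0`), for ANY re-straightening
`τ′` of the new state, `ŷ(clean σ_{c,a,τ′} F_{v+1}; frame (b;a,c)) ≤ ŷ(clean σ_{c,b,τ_eff} F_v; frame (a;b,c))` with the EFFECTIVE parameter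
`τ_eff = b_v(c) − τ′·b_v(a)` ALONE (the `σ_{c,a,τ′}`-translation of `…succ_beta_le'` removed by the V-lemma; its inputs are the (N5) facts of
§30).  With the cone-line dictionary of NODE-g29 §3ter (`b_v(c) = λ_v + λ_{v+1} b_v(a)` at a β-loss), `τ′ = λ_{v+1}` gives `τ_eff = λ_v`:
the ordinate potentials of consecutive wall states compare directly (hypothesis (h2) of `lawLossEntryAt_of_wallSteps'` at β-steps of
sub-case “next frame (b;a,c)”).
-/

open MvPolynomial Finset
open Literature.AlgebraicGeometry.Resolution
open Literature.AlgebraicGeometry.Resolution.Hauser2010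
open Literature.AlgebraicGeometry.Resolution.PointBlowup
open Summit.ResolutionOfSingularities.ResolutionOfSingularities.Theorems.TightDefectClasses
open Summit.ResolutionOfSingularities.ResolutionOfSingularities.Theorems.TightDefectStrongWalks
open Summit.ResolutionOfSingularities.ResolutionOfSingularities.Theorems.ItineraryCutClasses
open Summit.ResolutionOfSingularities.ResolutionOfSingularities.Theorems.BoundaryLedger
open Summit.ResolutionOfSingularities.ResolutionOfSingularities.Theorems.ProximityCut
open Summit.ResolutionOfSingularities.ResolutionOfSingularities.Theorems.LossExitCone
open Summit.ResolutionOfSingularities.ResolutionOfSingularities.Theorems.LossPolygon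

/-! ## §31 WALL-PRESERVING SHEARS DO NOT MOVE THE VERTEX — the V-lemma for the WALL letter (`σ_{c,a,κ}`, NODE-g29 §3ter (R2)) and the β-step law with the EFFECTIVE straightening only -/

namespace Summit.ResolutionOfSingularities.ResolutionOfSingularities.Theorems.LossPolygon

variable {K : Type} [Field K]

section WallShearVertex

variable {a b c : Fin 3}

/-- The abscissa of the point of a monomial with `n ≤ D c` letters `c` (the CEILING letter) converted into the wall letter `a`:
`(D a + n − r a)/(d + n)`, `d = s + r c − D c`. [new; elementary] -/
theorem fst_resPoint_shearExp_thd (hab : a ≠ b) (hac : a ≠ c) (hbc : b ≠ c) (s : ℕ) (r : Fin 3 →₀ ℕ) (D : Fin 3 →₀ ℕ)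
    {n : ℕ} (hn : n ≤ D c) :
    (resPoint s r a b c (shearExp a b c D n)).1 =
      ((((D a : ℕ) : ℚ)) + n - r a) / (((s : ℕ) : ℚ) + r c - D c + n) := by
  show ((((shearExp a b c D n a : ℕ) : ℚ)) - r a) / (((s : ℕ) : ℚ) + r c - (shearExp a b c D n c : ℕ)) = _
  rw [shearExp_apply_fst hab hac, shearExp_apply_thd hac hbc, Nat.cast_add, Nat.cast_sub hn]
  ring

/-- **V-LEMMA FOR THE WALL LETTER (PROVED):** a wall-preserving shear `σ_{c,a,κ} : u_c ↦ u_c + κ u_a` of the ceiling letter into the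
WALL letter `a` does not move the lex-min vertex of the frame-`(a, b ; c)` point set, provided the wall `u_a^{r a}` divides the equation,
the point set is non-empty and its abscissa is `< 1`.  Every spawned point (`n ≥ 1` converted letters) lies STRICTLY TO THE RIGHT of the
vertex: a source below the ceiling with abscissa `x < 1` moves right (`(X+n)/(d+n) > X/d` for `X < d`), a source with `x ≥ 1` stays at
abscissa `≥ 1`, a source above the ceiling lands at abscissa `≥ 1` (`d + n ≤ n ≤ X + n` by the wall); hence the vertex monomial is
unreachable and keeps its coefficient.  (Companion of `vertexOf_polyPts_shear_snd`, the V-lemma for the section letter.) [new] -/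
theorem vertexOf_polyPts_shear_wall (hab : a ≠ b) (hac : a ≠ c) (hbc : b ≠ c) {s : ℕ} {r : Fin 3 →₀ ℕ} (κ : K)
    {G : MvPolynomial (Fin 3) K} (hwall : ∀ D ∈ G.support, r a ≤ D a)
    (hne : (polyPts s r a b c G).Nonempty) (hα : alphaOf (polyPts s r a b c G) < 1) :
    vertexOf (polyPts s r a b c (shear c a κ G)) = vertexOf (polyPts s r a b c G) ∧
      ∃ Dv ∈ G.support, Dv ∈ (shear c a κ G).support ∧ Dv c < s + r c ∧
        resPoint s r a b c Dv = vertexOf (polyPts s r a b c G) := by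
  classical
  obtain ⟨Dv, hDv, hDve⟩ := Finset.mem_image.mp (vertexOf_mem hne)
  obtain ⟨hDvG, hDvc⟩ := Finset.mem_filter.mp hDv
  have hpos : ∀ D : Fin 3 →₀ ℕ, D c < s + r c → (0 : ℚ) < ((s : ℕ) : ℚ) + r c - D c := fun D hD => by
    have : ((D c : ℕ) : ℚ) < ((s + r c : ℕ) : ℚ) := by exact_mod_cast hD
    push_cast at this; linarith
  -- KEY: a spawned point (`n ≥ 1`) below the ceiling lies strictly to the right of the vertex
  have hkey : ∀ D ∈ G.support, ∀ n, 1 ≤ n → n ≤ D c → shearExp a b c D n c < s + r c →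
      alphaOf (polyPts s r a b c G) < (resPoint s r a b c (shearExp a b c D n)).1 := by
    intro D hD n hn1 hnD hEc
    have hx := fst_resPoint_shearExp_thd hab hac hbc s r D hnD
    have hn1' : (1 : ℚ) ≤ n := by exact_mod_cast hn1
    have hd'pos : (0 : ℚ) < ((s : ℕ) : ℚ) + r c - D c + n := by
      rw [shearExp_apply_thd hac hbc] at hEc
      have h2 : ((D c - n : ℕ) : ℚ) < ((s + r c : ℕ) : ℚ) := by exact_mod_cast hEc
      rw [Nat.cast_sub hnD] at h2
      push_cast at h2
      linarith
    by_cases hDc : D c < s + r c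
    · -- source below the ceiling: a point of the set, abscissa `≥ α`
      have hmem : resPoint s r a b c D ∈ polyPts s r a b c G :=
        Finset.mem_image_of_mem _ (Finset.mem_filter.mpr ⟨hD, hDc⟩)
      have hαle : alphaOf (polyPts s r a b c G) ≤ (resPoint s r a b c D).1 := alphaOf_le_fst hmem
      have hxD : (resPoint s r a b c D).1 = ((((D a : ℕ) : ℚ)) - r a) / (((s : ℕ) : ℚ) + r c - D c) := rfl
      have hdpos := hpos D hDc
      by_cases hx1 : (((D a : ℕ) : ℚ)) - r a < ((s : ℕ) : ℚ) + r c - D c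
      · -- `x(D) < 1`: the spawn is strictly to the right of `x(D)`
        have hlt : (resPoint s r a b c D).1 < (resPoint s r a b c (shearExp a b c D n)).1 := by
          rw [hx, hxD, div_lt_div_iff₀ hdpos hd'pos]
          have hmul : ((((D a : ℕ) : ℚ)) - r a) * (n : ℚ) < (((s : ℕ) : ℚ) + r c - D c) * (n : ℚ) :=
            mul_lt_mul_of_pos_right hx1 (by linarith)
          nlinarith [hmul]
        exact hαle.trans_lt hlt
      · -- `x(D) ≥ 1`: the spawn has abscissa `≥ 1 > α`
        push Not at hx1
        have h1 : (1 : ℚ) ≤ (resPoint s r a b c (shearExp a b c D n)).1 := by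
          rw [hx, le_div_iff₀ hd'pos]; linarith
        exact hα.trans_le h1
    · -- source above the ceiling: `d + n ≤ n ≤ X + n`, abscissa `≥ 1 > α`
      push Not at hDc
      have hwa : ((r a : ℕ) : ℚ) ≤ D a := by exact_mod_cast hwall D hD
      have hDc' : ((s : ℕ) : ℚ) + r c ≤ D c := by exact_mod_cast hDc
      have h1 : (1 : ℚ) ≤ (resPoint s r a b c (shearExp a b c D n)).1 := by
        rw [hx, le_div_iff₀ hd'pos]; linarith
      exact hα.trans_le h1
  -- (A) the vertex monomial keeps its coefficient
  have hreach : ∀ D ∈ G.support, ∀ n, 1 ≤ n → n ≤ D c → shearExp a b c D n ≠ Dv := by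
    intro D hD n hn1 hnD hE
    have hEc : shearExp a b c D n c < s + r c := by rw [hE]; exact hDvc
    have h := hkey D hD n hn1 hnD hEc
    rw [hE, hDve] at h
    unfold alphaOf at h
    exact lt_irrefl _ h
  have hcoeff : coeff Dv (shear c a κ G) = coeff Dv G := coeff_shear_eq_coeff hab hac hbc κ G hreach
  have hDvS : Dv ∈ (shear c a κ G).support := by
    rw [mem_support_iff, hcoeff]; exact mem_support_iff.mp hDvG
  refine ⟨vertexOf_eq (Finset.mem_image.mpr ⟨Dv, Finset.mem_filter.mpr ⟨hDvS, hDvc⟩, hDve⟩) fun w hw => ?_,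
    Dv, hDvG, hDvS, hDvc, hDve⟩
  -- (B) every point of the sheared set is lexicographically above the vertex
  obtain ⟨E, hE, rfl⟩ := Finset.mem_image.mp hw
  obtain ⟨hES, hEc⟩ := Finset.mem_filter.mp hE
  obtain ⟨D, hD, n, hnD, hDE⟩ := exists_shearExp_eq_of_mem_support_shear hab hac hbc κ G hES
  rcases Nat.eq_zero_or_pos n with hn0 | hnpos
  · subst hn0
    rw [shearExp_zero hab hac hbc] at hDE
    subst hDE
    exact vertexOf_le (Finset.mem_image_of_mem _ (Finset.mem_filter.mpr ⟨hD, hEc⟩))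
  · have hEc' : shearExp a b c D n c < s + r c := by rw [hDE]; exact hEc
    have h := hkey D hD n hnpos hnD hEc'
    rw [hDE] at h
    unfold alphaOf at h
    rw [toLex_le_toLex_iff]
    exact Or.inl h

/-- Corollary: the ordinate `ŷ` (and the abscissa) of the frame-`(a, b ; c)` point set is unchanged by the wall-preserving shear
`σ_{c,a,κ}`. [new] -/
theorem betaOf_polyPts_shear_wall (hab : a ≠ b) (hac : a ≠ c) (hbc : b ≠ c) {s : ℕ} {r : Fin 3 →₀ ℕ} (κ : K)
    {G : MvPolynomial (Fin 3) K} (hwall : ∀ D ∈ G.support, r a ≤ D a)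
    (hne : (polyPts s r a b c G).Nonempty) (hα : alphaOf (polyPts s r a b c G) < 1) :
    betaOf (polyPts s r a b c (shear c a κ G)) = betaOf (polyPts s r a b c G) ∧
      alphaOf (polyPts s r a b c (shear c a κ G)) = alphaOf (polyPts s r a b c G) := by
  have h := (vertexOf_polyPts_shear_wall hab hac hbc κ hwall hne hα).1
  unfold betaOf alphaOf
  rw [h]
  exact ⟨rfl, rfl⟩

end WallShearVertex

/-! ### The β-step law with the EFFECTIVE straightening only (walk level; NODE-g29 §3ter) -/

section BetaStepEffective

variable {q : ℕ} [DecidableEq K] {s₀ : State (Fin 3) K}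

/-- **β-STEP ORDINATE LAW, EFFECTIVE FORM (PROVED; all polygon inputs discharged):** at a β-loss `v` (chart `b` = the section letter,
off the wall: `b_v(a) ≠ 0`; one-wall states `M e_a → M′ e_b`), for ANY straightening parameter `τ′` of the new state in the frame
`(b, a ; c)`, the new ordinate is at most the ordinate of the source straightened by the EFFECTIVE parameter
`τ_eff = b_v(c) − τ′·b_v(a)` ALONE — the wall-preserving translation `σ_{c,a,τ′}` of `betaOf_polyPts_straightened_succ_beta_le'`
is removed by the V-lemma for the wall letter (`vertexOf_polyPts_shear_wall`; its inputs — wall divisibility, non-emptiness,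
abscissa `< 1` of the straightened source — are the (N5) facts of §30).  With the cone-line dictionary of NODE-g29 §3ter
(`b_v(c) = λ_v + λ_{v+1}·b_v(a)`), `τ′ = λ_{v+1}` makes `τ_eff = λ_v`: the potentials of consecutive wall states compare DIRECTLY. [new] -/
theorem betaOf_polyPts_straightened_succ_beta_le'' (hs : IsRoot q s₀) (W : ForcedWalk q s₀) (v : ℕ) {a b c : Fin 3}
    (hab : a ≠ b) (hac : a ≠ c) (hbc : b ≠ c) (hj : W.j v = b)
    (hLucas : ∀ D T : ℕ, q ∣ D → ¬ q ∣ T → ((D.choose T : ℕ) : K) = 0) (τ' : K) {s M M' : ℕ} (hoM : q + M' = M + s)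
    (hord : ∀ D ∈ (W.st v).F.support, M + s ≤ D.degree) (hrva : (W.st v).r a = M) (hrvb : (W.st v).r b = 0)
    (hrvc : (W.st v).r c = 0) (hr₁b : (W.st (v + 1)).r b = M') (hr₁a : (W.st (v + 1)).r a = 0) (hr₁c : (W.st (v + 1)).r c = 0)
    (hg : W.b v a ≠ 0) (hsq : s < q) (hqo : q < M + s) (hos : 2 * q + 1 ≤ M + s + s) :
    betaOf (polyPts s (W.st (v + 1)).r b a c (deletePthPowers q (shear c a τ' (W.st (v + 1)).F))) ≤
      betaOf (polyPts s (W.st v).r a b c (deletePthPowers q (shear c b (W.b v c - τ' * W.b v a) (W.st v).F))) := by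
  have h := betaOf_polyPts_straightened_succ_beta_le' hs W v hab hac hbc hj hLucas τ' hoM hord hrva hrvb hrvc hr₁b hr₁a
    hr₁c hg hsq hqo hos
  have hq : q ≤ s + (W.st v).r a := by rw [hrva]; omega
  have hV := (betaOf_polyPts_shear_wall hab hac hbc τ'
    (fun D hD => wall_le_of_mem_support_straightened hs W v hab hac hbc (W.b v c - τ' * W.b v a) hD)
    (polyPts_straightened_nonempty hs W v hab hac hbc (W.b v c - τ' * W.b v a) hLucas hq hrvc)
    (alphaOf_polyPts_straightened_lt_one hs W v hab hac hbc (W.b v c - τ' * W.b v a) hLucas hq hrvc)).1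
  rw [hV] at h
  exact h

end BetaStepEffective

end Summit.ResolutionOfSingularities.ResolutionOfSingularities.Theorems.LossPolygon
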